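import Summits.QuantumFields.YangMills.Theorems.BalabanUVNodesN10B13BondTowerReduced
import Literature.MathematicalPhysics.QuantumFieldTheory.Balaban1983to89.B13ChainJointNonvacuityPrefactorsVol

/-!
# THE [B13] LEAF OF RECORD IS INHABITED AT THE BOND TOWER — the junction of record's joint inhabitant (cell `pub-ymgap`, node N10, seat n10-w3 g4, item (c))

T. Bałaban, *Renormalization group approach to lattice gauge field theories. II. Cluster expansions*, Commun. Math. Phys. **116** (1988) 1–22
[Balaban1988RG2Cluster], p. 21 (closing paragraph): *"The assumptions allow finally us to fix all the constants, or rather bounds on these constants."*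

WHAT THIS FILE PROVES (0 `sorry`).  ★★★ `b13LeafOfRecord_bondTower_inhabited` (+ corollary `b13LeafOfRecord_inhabited : ∃ lamD : ResidB13D θ, B13LeafOfRecord θ lamD.toC.toK.layer` for
every `θ` with `8 ≤ θ.ℓ₆ + 1`): for EVERY Stage-3′ parameter record `θ` with block size
`θ.ℓ₆ + 1 ≥ 8` and every `n k m₃` with `12 ≤ (θ.ℓ₆+1)(n+1)`, there are a constants record `c` (namely `constsOddL (θ.ℓ₆+1) (κw+1) α₄` of
`B13ChainJointNonvacuityOddL`), a coupling `g ≠ 0` (`ε₁∕r_P`) and a radius `R` (`⌈R_σ⌉₊`) such that `B13LeafOfRecord θ (bondTower θ n k m₃ c g R).toC.toK.layer`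
holds — by `b13LeafOfRecord_bondTower_of_numerics` (p621116: the junction of record 67V ∕ 67VL at the bond tower, objects discharged) fed with the joint
numerics witness `junction_numerals_joint_witness_vol` (every real letter at once, at the record's ODD block size, volume binder located).  So the
junction of record (`…DecoratedDialsLocatedVol` ∕ `…VolDials`) is NOT vacuous: its ≈ 150 binders are met simultaneously by an explicit decorated tower.

HONEST SCOPE.  An inhabitant of TYPED hypothesis lists at explicit witness data (astronomical constants, the bond tower's product-Haar ∕ character
carriers of `CarriersB13BondTower`); the conclusion `B13LeafOfRecord` is the cell's typed leaf predicate AT THAT TOWER, nothing more; nothing of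
Bałaban's asserted beyond what the junction's imports prove; which tower the N10 term of record uses stays NODE 00's word.  Count-neutral; N10 NOT
discharged; K1⁸ (stmt-QuantumFields-26907) NOT claimed — no registered stub is proved here; one finite four-torus programme at fixed ε; R4 closes the
conditional finite-𝕋⁴ rung `BalabanLadder.UV` only; the YM mass gap (Clay) is NOT proved by any of this; nothing continuum ∕ ℝ⁴ ∕ OS.
-/

noncomputable section

namespace Summit.QuantumFields.YangMills.BalabanUVNodes.N10B13BondTowerInhabited

open Literature.MathematicalPhysics.QuantumFieldTheory.Balaban1983to89
open Literature.MathematicalPhysics.QuantumFieldTheory.Balaban1983to89.DagBinding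
open Literature.MathematicalPhysics.QuantumFieldTheory.Balaban1983to89.Node00
open Literature.MathematicalPhysics.QuantumFieldTheory.Balaban1983to89.B13Lemma3WindowNonvacuity (κw aw)
open Literature.MathematicalPhysics.QuantumFieldTheory.Balaban1983to89.B13ChainJointNonvacuityOddL (constsOddL shiftE)
open Literature.MathematicalPhysics.QuantumFieldTheory.Balaban1983to89.B13ChainJointNonvacuityPrefactorsVol (junction_numerals_joint_witness_vol)
open Summit.QuantumFields.YangMills.BalabanUVNodes.N10B13BondTowerReduced (b13LeafOfRecord_bondTower_of_numerics)

/-- ★★★ **THE [B13] LEAF OF RECORD IS INHABITED AT THE BOND TOWER.**  For every `θ` with `8 ≤ θ.ℓ₆ + 1` and `n k m₃` with `12 ≤ (θ.ℓ₆+1)(n+1)`: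
`∃ c g R, B13LeafOfRecord θ (bondTower θ n k m₃ c g R).toC.toK.layer` — the junction of record applied NON-VACUOUSLY (numerics by
`junction_numerals_joint_witness_vol`, objects by `CarriersB13BondTower`, composition by `b13LeafOfRecord_bondTower_of_numerics`); the witnesses are
`c := constsOddL (θ.ℓ₆+1) M α₄`, `g := ε₁∕r_P ∈ ℝ_{>0} ⊂ ℂ`, `R := ⌈R_σ⌉₊`.
[cite: Balaban1988RG2Cluster, Lemma 1 p.9, Lemma 2 p.11, Lemma 3 p.20, (2.14)–(2.26) pp.15–17, p.21 (closing paragraph); Balaban1987RG1, p.253] -/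
theorem b13LeafOfRecord_bondTower_inhabited (θ : Stage3Params) (hL8 : 8 ≤ θ.ℓ₆ + 1) (n k m₃ : ℕ) (hN12 : 12 ≤ (θ.ℓ₆ + 1) * (n + 1)) :
    ∃ (c : B13.Consts) (g : ℂ) (R : ℕ), B13LeafOfRecord θ (bondTower θ n k m₃ c g R).toC.toK.layer := by
  obtain ⟨c, cp, rf, R₁, θ₀, γ₂, rP, ρΔ, BΔ, ηΔ, μΔ, M₁, ⟨M, α, hM, hα0, rfl⟩,
    ⟨hκ, hδ1, hδκ, hκ126, hκ126', hκ₁, hκ₁', hδ₀, hM0, hδ₀M, hδ₀M5, hR8, hR9, hC₃⟩,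
    ⟨hN, h12, hE, hε, hC₁, hα, hM1, hτ2⟩, hκp,
    ⟨hrf, hR₁def, hp, hη, hθ₀, hθle, hRσloc, hm04, hnB1, hdm1, hεL, hκL, hKL, hεA, hκA, hKA, hmA⟩,
    ⟨hB4, hηΔ, hP2, hμΔ, hbudget, hkbar⟩, ⟨hγ₂, hγle, hM4, hrP, hPa⟩, ⟨hθvol, hγvol, hαM, hαK⟩⟩ :=
    junction_numerals_joint_witness_vol (θ.ℓ₆ + 1) m₃ hL8
  -- the coupling `g := ε₁ ∕ r_P` (real, positive) and the radius `R := ⌈R_σ⌉₊`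
  have hgpos : 0 < (constsOddL (θ.ℓ₆ + 1) M α).ε₁ / rP := div_pos hε hrP
  have hg : (((constsOddL (θ.ℓ₆ + 1) M α).ε₁ / rP : ℝ) : ℂ) ≠ 0 := by exact_mod_cast hgpos.ne'
  have hnorm : ‖(((constsOddL (θ.ℓ₆ + 1) M α).ε₁ / rP : ℝ) : ℂ)‖ = (constsOddL (θ.ℓ₆ + 1) M α).ε₁ / rP := by
    rw [Complex.norm_real, Real.norm_eq_abs, abs_of_pos hgpos]
  have hquot : (constsOddL (θ.ℓ₆ + 1) M α).ε₁ / ‖(((constsOddL (θ.ℓ₆ + 1) M α).ε₁ / rP : ℝ) : ℂ)‖ = rP := by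
    rw [hnorm]
    field_simp
  have hPa' : aw + 40 * Real.log ((m₃ + 1 : ℕ) : ℝ) + 20 * shiftE (θ.ℓ₆ + 1) + 8 * (((θ.ℓ₆ + 1 : ℕ) : ℝ) - 8) ≤
      γ₂ * ((constsOddL (θ.ℓ₆ + 1) M α).ε₁ / ‖(((constsOddL (θ.ℓ₆ + 1) M α).ε₁ / rP : ℝ) : ℂ)‖) ^ 2 := by
    rw [hquot]; exact hPa
  have hRσR : rf.Rσ ≤ ((⌈rf.Rσ⌉₊ : ℕ) : ℝ) + 1 := by
    have := Nat.le_ceil rf.Rσ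
    linarith
  exact ⟨constsOddL (θ.ℓ₆ + 1) M α, (((constsOddL (θ.ℓ₆ + 1) M α).ε₁ / rP : ℝ) : ℂ), ⌈rf.Rσ⌉₊,
    b13LeafOfRecord_bondTower_of_numerics θ n k m₃ (constsOddL (θ.ℓ₆ + 1) M α) _ ⌈rf.Rσ⌉₊ hN12 hL8
      hκ hδ1 hδκ hκ126 hκ126' hκ₁ hκ₁' hδ₀ hM0 hδ₀M hδ₀M5 hR8 hR9 hC₃
      hN h12 hE hε hC₁ hα hM1 hτ2 cp hκp hg hγ₂
      rf hrf hR₁def hp hη hθ₀ hθle hRσloc hm04 hRσR hnB1 hdm1 hεL hκL hKL hεA hκA hKA hmA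
      hB4 hηΔ hP2 hμΔ hbudget hkbar hγle hM4 hPa' hθvol hγvol hαM hαK⟩

/-- ★ **COROLLARY: THE [B13] LEAF-OF-RECORD PREDICATE IS INHABITED BY A DECORATED RESIDUAL TOWER** for every Stage-3′ record with block size
`θ.ℓ₆ + 1 ≥ 8`: `∃ lamD : ResidB13D θ, B13LeafOfRecord θ lamD.toC.toK.layer` (the bond tower at `n = 1`, `k = m₃ = 0`, so `12 ≤ (ℓ₆+1)·2`).  The junction
of record's hypothesis list is therefore jointly satisfiable at every such `θ` — nothing about WHICH tower NODE 00 designates.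
[cite: Balaban1988RG2Cluster, p.21 (closing paragraph); Balaban1987RG1, p.253] -/
theorem b13LeafOfRecord_inhabited (θ : Stage3Params) (hL8 : 8 ≤ θ.ℓ₆ + 1) :
    ∃ lamD : ResidB13D θ, B13LeafOfRecord θ lamD.toC.toK.layer := by
  obtain ⟨c, g, R, h⟩ := b13LeafOfRecord_bondTower_inhabited θ hL8 1 0 0 (by omega)
  exact ⟨bondTower θ 1 0 0 c g R, h⟩

end Summit.QuantumFields.YangMills.BalabanUVNodes.N10B13BondTowerInhabited

end
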